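import Summits.AnomalousDissipation.AnomalousDissipation.Theorems.SolenoidalFractalHomogenisationRealisedQuasiStaticCellLawWeakFarAtCell
import Summits.AnomalousDissipation.AnomalousDissipation.Theorems.SolenoidalFractalHomogenisationRealisedQuasiStaticCellLawSectorRelabel
import HarnessLib

/-!
# K2R `RealisedQuasiStaticCellLaw`, line `floquet-bloch`: the registered stub `stub_lowSectorWeakFar` (W-far road)
# (`--supports stmt-AnomalousDissipation-20446`)

Summits-side file (everything proved; no definitions, no named facts). The registered stub of skeleton r17, verbatim: for
every `δ > 0` there is `M₀ = 10` such that for `M ≥ M₀`, with `ν₀ = 1` and `K = 8π²·3720·M(1 + c_W) + 300`, every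
sector `±ℓ + nℤ³` (`n ≥ ⌈K/ν⌉`) having a representative `k ≠ 0` with `4 ≤ |k|² < 1 + (1−δ)c_W/ν²` and
`‖k‖ ≤ (δ/10⁴)·nν` (weakly coupled, far shell) decays under the replayed cell word at the rate
`8π²(1 + (1−δ)c_W/ν²)ν/n²` with prefactor `K/ν` — by `weakFar_decay_at_cell` applied to the representative `k`
(`sector_iff_of_rep` moves the Fourier-support hypothesis from `ℓ` to `k`; `δ ≤ 1` is forced by `4 ≤ |k|²`).
-/

set_option linter.dupNamespace false

noncomputable section

namespace Summit.AnomalousDissipation.AnomalousDissipation.Theorems.SolenoidalFractalHomogenisation.RealisedQuasiStaticCellLaw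

open Set MeasureTheory
open Literature.Analysis Literature.Analysis.FunctionSpaces Literature.Analysis.FunctionSpaces.Torus
open Literature.Analysis.FluidPDE Literature.Analysis.FluidPDE.LatticeShear

/-- **Stub `stub_lowSectorWeakFar` of skeleton r17 (W-far road), registered signature.** -/
theorem stub_lowSectorWeakFar : ∀ δ > (0:ℝ), ∃ M₀ > (0:ℝ), ∀ M : ℝ, ∀ hM : 0 < M, M₀ ≤ M → ∃ ν₀ > (0:ℝ), ∃ K > (0:ℝ),
    ∀ ν, ∀ hν : ν ∈ Ioo 0 ν₀, ∀ n : ℕ, ⌈K / ν⌉₊ ≤ n → ∀ ℓ : Fin 3 → ℤ,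
    (∃ k : Fin 3 → ℤ, ((∃ z : Fin 3 → ℤ, k = ℓ + (n:ℤ) • z) ∨ (∃ z : Fin 3 → ℤ, k = -ℓ + (n:ℤ) • z)) ∧ k ≠ 0 ∧
      FunctionSpaces.Torus.freqNormSq k < 1 + (1 - δ) * ((1 - 4 * cubatureWord.ramp / 3) * c0) / ν ^ 2 ∧
      ‖FunctionSpaces.Torus.latticeVec k‖ ≤ δ / 10000 * ((n:ℝ) * ν) ∧ 4 ≤ FunctionSpaces.Torus.freqNormSq k) →
    ∀ w₀ : UnitAddTorus (Fin 3) → EuclideanSpace ℝ (Fin 3),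
      FunctionSpaces.Torus.MemSobolev 1 (FunctionSpaces.EuclideanSpace.complexify ∘ w₀) →
      FunctionSpaces.Torus.IsWeaklyDivFree w₀ → FunctionSpaces.Torus.HasZeroMean w₀ →
      (∀ k : Fin 3 → ℤ, ¬ ((∃ z : Fin 3 → ℤ, k = ℓ + (n:ℤ) • z) ∨ (∃ z : Fin 3 → ℤ, k = -ℓ + (n:ℤ) • z)) →
        UnitAddTorus.mFourierCoeff (FunctionSpaces.EuclideanSpace.complexify ∘ w₀) k = 0) → ∀ T > (0:ℝ), ∀ w,
      Torus.IsWeakPassiveVectorOn 0 T (ν / (n:ℝ) ^ 2)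
          (((cubatureWord.stretch M hM).stretch (1 / ν) (one_div_pos.mpr hν.1)).cell n) w₀ w →
      ∀ᵐ t ∂(volume.restrict (Ioo 0 T)),
        ∫ x, ‖w t x‖ ^ 2 ≤ (K / ν) *
          Real.exp (-(8 * Real.pi ^ 2 * (1 + (1 - δ) * ((1 - 4 * cubatureWord.ramp / 3) * c0) / ν ^ 2) * ν
            / (n:ℝ) ^ 2) * t) * ∫ x, ‖w₀ x‖ ^ 2 := by
  intro δ hδ
  have hρ : cubatureWord.ramp = 1 / 2 := (cubature_phase_fields 0).2.2.2
  have hcW : 0 < (1 - 4 * cubatureWord.ramp / 3) * c0 := by have := c0_pos; rw [hρ]; positivity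
  refine ⟨10, by norm_num, fun M hM hM10 => ⟨1, one_pos,
    8 * Real.pi ^ 2 * 3720 * M * (1 + (1 - 4 * cubatureWord.ramp / 3) * c0) + 300, by positivity, ?_⟩⟩
  intro ν hν n hn ℓ hsec w₀ hw₀ hdiv hmean hsupp T hT w hw
  obtain ⟨k, hkℓ, hk0, hkQ, hksmall, hk4⟩ := hsec
  -- `δ ≤ 1`: otherwise `4 ≤ |k|² < 1 + (1 − δ)c_W/ν² ≤ 1`
  have hδ1 : δ ≤ 1 := by
    by_contra h
    have h1 : (1 - δ) * ((1 - 4 * cubatureWord.ramp / 3) * c0) / ν ^ 2 ≤ 0 :=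
      div_nonpos_of_nonpos_of_nonneg (mul_nonpos_of_nonpos_of_nonneg (by linarith) hcW.le) (by positivity)
    linarith
  have hKn : 8 * Real.pi ^ 2 * 3720 * M * (1 + (1 - 4 * cubatureWord.ramp / 3) * c0) + 300 ≤ (n : ℝ) * ν :=
    (div_le_iff₀ hν.1).mp (Nat.ceil_le.mp hn)
  -- the Fourier support in terms of the representative `k`
  have hsupp' : ∀ k' : Fin 3 → ℤ, ¬ ((∃ z : Fin 3 → ℤ, k' = k + (n:ℤ) • z) ∨ (∃ z : Fin 3 → ℤ, k' = -k + (n:ℤ) • z)) →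
      UnitAddTorus.mFourierCoeff (FunctionSpaces.EuclideanSpace.complexify ∘ w₀) k' = 0 :=
    fun k' hk' => hsupp k' fun h => hk' ((sector_iff_of_rep hkℓ k').mp h)
  exact weakFar_decay_at_cell hδ hδ1 hM hM10 hν.1 hν.2.le hKn k hk0 hk4 hksmall hw₀ hdiv hmean hsupp' hT hw

end Summit.AnomalousDissipation.AnomalousDissipation.Theorems.SolenoidalFractalHomogenisation.RealisedQuasiStaticCellLaw

end
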